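import Literature.NumberTheory.GaloisRepresentations.HasseNormEtaleInvolutionFactors
import Literature.NumberTheory.Automorphic.AdeleGaloisDescent
import Literature.NumberTheory.GaloisRepresentations.QuadraticArtinIndicatorFixedField
import HarnessLib

/-!
# Descent at a `τ`-stable factor: the idele of the fixed field `C^τ` under a `τ`-fixed idele of `C`, principal ideles and
# idelic norms (Cassels–Fröhlich VII §7.3 (a) `J_K ≃ J_L^G`; Rogawski 1990 §3.5 Prop. 3.5.2)

Topic `NumberTheory/GaloisRepresentations`; namespace `Literature.NumberTheory.GaloisRepresentations`.  THEOREMS ONLY (no definition, no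
instance, no notation, no named fact; D-0026, net debt 0); universe `Type`.  Third sequel of ★ `HasseNormEtaleInvolution` (§1 there: the
fixed field `C^τ := fixedField ⟨τ⟩` of an involution `τ ≠ 1` of a number field `C`, `Aut(C/C^τ) = {1, τ}`), after ★ `…Factors` ((D1):
the projection of a `τ_B`-fixed unit of `𝔸_F ⊗_F B` to a `τ_B`-stable factor `π : B → C` is a `τ`-FIXED idele of `C`).  Here the
descent `𝕀_C^{⟨τ⟩} = 𝕀_{C^τ}` (★ `AdeleRing.mem_range_ideleBaseChange_of_forall_smul_eq`, [CasselsFrohlichANT1967, VII §7.3 (a)]) is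
packaged for the row G6∕R6d (`Rogawski1990/CartanObstruction`): the obstruction of [Rogawski1990, §3.5 Prop. 3.5.2 (c)] is read, factor by
factor, on the DESCENDED idele `W ∈ 𝕀_{C^τ}` through the quadratic norm-residue indicator of `C ∕ C^τ` (★ `QuadraticArtinIndicator`,
★ `QuadraticIdeleNormResidueExact`).  The `IsGalois C^τ C` binder is ★ `isGalois_fixedField_zpowers`.

* §1 `mem_zpowers_subgroupEquivAlgEquiv` (every element of `Aut(C/C^τ)` is a power of `τ`), `forall_smul_eq_of_smul_eq` (a `τ`-fixed idele
  is `Aut(C/C^τ)`-fixed), **(E1) `existsUnique_ideleBaseChange_eq_of_smul_eq`** (`τ • Y = Y ⇒ ∃! W, con W = Y`),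
  **(E2) `ideleBaseChange_ideleRelNorm_eq_mul_smul`** (`con(N_{C/C^τ} Y) = Y · τ • Y`), **(E3) `ideleBaseChange_principal_eq`**
  (`con((a)_{C^τ}) = (a)_C` for `τ a = a ≠ 0`), `coe_ideleBaseChange_principal`, and the JUNCTION **(E5)
  `coe_ideleBaseChange_principal_mul_ideleRelNorm`**: `con((k) · N Z) = (k)_C · (Z · τ • Z)` — «`W = (k) · N(Z)`» of
  ★ `quadraticArtinIndicator_eq_zero_iff_exists_ideleRelNorm` ⟺ the hypothesis shape of ★ (D4) `exists_repr_of_adeleRingTensorAlgEquiv_map_eq`.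
* §2 at a factor `(π : B →ₐ[F] C, τ_B, τ, π ∘ τ_B = τ ∘ π)`: `smul_unitsMap_eq_self` (the idele `Z_π(X) = e_C((1 ⊗ π) X)` of a `τ_B`-fixed
  adelic unit `X` is `τ`-fixed, so (E1) applies), and **(E4) `ideleBaseChange_principal_mul_ideleRelNorm_eq`**:
  `con((π b)_{C^τ} · N_{C/C^τ}(Z_π(t))) = Z_π((1 ⊗ b) · t · (1 ⊗ τ_B)t)` — the descended idele of a «global × norm» is principal times
  an idelic norm (with (E1)'s uniqueness: `W = (π b) · N(Z_π t)`).
* §3 (ed. 2) **(P4 AT A FACTOR) `quadraticArtinIndicator_eq_zero_iff_exists_repr`**: for the descended idele `W` of `X` at the factor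
  (`con W = Z_π(X)`), `quadraticArtinIndicator C^τ d W = 0 ↔` the representative data of (D3) exist at this factor — (→) by
  ★ `QuadraticArtinIndicatorFixedField` (J4) `quadraticArtinIndicator_fixedField_eq_zero_iff` (`C = C^τ(√d)` presented by `δ`,
  `τδ = −δ`, `δ² = d`: `[W]_{C^τ,d} = 0 ↔ W = (k) · N Z`) + (E5) + ★ (D4); (←) by the norm reading ★ (D1) + (E5) + injectivity of the
  base change.

## References
* J. W. S. Cassels, A. Fröhlich (eds.), *Algebraic Number Theory* (1967), Ch. VII (Tate) §7.1, §7.3 Prop. (a) [CasselsFrohlichANT1967].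
* J. D. Rogawski, *Automorphic Representations of Unitary Groups in Three Variables*, Ann. of Math. Stud. 123 (1990), §3.5 Prop. 3.5.2
  [Rogawski1990].
* S. Lang, *Algebra*, 3rd ed. (2002), Ch. VI §1 Thm. 1.8 (Artin) [Lang2002].
-/

noncomputable section

open NumberField IsDedekindDomain
open scoped TensorProduct

namespace Literature.NumberTheory.GaloisRepresentations

/-! ## §1 (E1)–(E3) Descent along `C ∕ C^τ` for an involution `τ ≠ 1` of a number field `C` -/

section Descent

open scoped NumberField.AdeleRing
open Literature.NumberTheory.AdelicBaseChange Literature.NumberTheory.Automorphic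

variable {F C : Type} [Field F] [NumberField F] [Field C] [NumberField C] [Algebra F C] (τ : C ≃ₐ[F] C)

/-- Every `C^τ`-automorphism of `C` is a power of `τ` (as the Galois automorphism `subgroupEquivAlgEquiv ⟨τ⟩ τ`).
[cite: Lang2002, Ch. VI §1 Thm. 1.8 (Artin)] -/
theorem mem_zpowers_subgroupEquivAlgEquiv (σ : C ≃ₐ[IntermediateField.fixedField (Subgroup.zpowers τ)] C) :
    σ ∈ Subgroup.zpowers (IntermediateField.subgroupEquivAlgEquiv (Subgroup.zpowers τ) ⟨τ, Subgroup.mem_zpowers τ⟩) := by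
  obtain ⟨g, rfl⟩ := (IntermediateField.subgroupEquivAlgEquiv (Subgroup.zpowers τ)).surjective σ
  obtain ⟨n, hn⟩ := Subgroup.mem_zpowers_iff.1 g.2
  have hg : g = (⟨τ, Subgroup.mem_zpowers τ⟩ : Subgroup.zpowers τ) ^ n := Subtype.ext (by rw [SubgroupClass.coe_zpow]; exact hn.symm)
  rw [hg, map_zpow]
  exact Subgroup.zpow_mem_zpowers _ n

/-- **A `τ`-fixed idele of `C` is fixed by all of `Gal(C ∕ C^τ)`.** [cite: CasselsFrohlichANT1967, Ch. VII §7.3 (a)] -/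
theorem forall_smul_eq_of_smul_eq {Y : (AdeleRing (𝓞 C) C)ˣ} (hY : τ • Y = Y)
    (σ : C ≃ₐ[IntermediateField.fixedField (Subgroup.zpowers τ)] C) : σ • Y = Y := by
  have hstab : IntermediateField.subgroupEquivAlgEquiv (Subgroup.zpowers τ) ⟨τ, Subgroup.mem_zpowers τ⟩ ∈
      MulAction.stabilizer (C ≃ₐ[IntermediateField.fixedField (Subgroup.zpowers τ)] C) Y := by
    rw [MulAction.mem_stabilizer_iff, subgroupEquivAlgEquiv_zpowers_smul_idele, hY]
  exact (Subgroup.zpowers_le.2 hstab) (mem_zpowers_subgroupEquivAlgEquiv τ σ)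

/-- **(E1) descent of a `τ`-fixed idele to the fixed field**: `Y = con(W)` for a UNIQUE idele `W` of `C^τ` (`𝕀_C^{G} = 𝕀_{C^τ}`,
★ `AdeleRing.mem_range_ideleBaseChange_of_forall_smul_eq`, injectivity of the base change).
[cite: CasselsFrohlichANT1967, Ch. VII §7.3 (a)] -/
theorem existsUnique_ideleBaseChange_eq_of_smul_eq [IsGalois (IntermediateField.fixedField (Subgroup.zpowers τ)) C]
    {Y : (AdeleRing (𝓞 C) C)ˣ} (hY : τ • Y = Y) :
    ∃! W : (AdeleRing (𝓞 ↥(IntermediateField.fixedField (Subgroup.zpowers τ))) ↥(IntermediateField.fixedField (Subgroup.zpowers τ)))ˣ,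
      AdeleRing.ideleBaseChange (↥(IntermediateField.fixedField (Subgroup.zpowers τ))) C W = Y := by
  obtain ⟨W, hW⟩ := AdeleRing.mem_range_ideleBaseChange_of_forall_smul_eq (↥(IntermediateField.fixedField (Subgroup.zpowers τ))) C
    (forall_smul_eq_of_smul_eq τ hY)
  exact ⟨W, hW, fun W' hW' => AdeleRing.ideleBaseChange_injective _ C (hW'.trans hW.symm)⟩

/-- **(E2) the idelic norm of `C ∕ C^τ` reads `Y · τY` after base change**: `con(N_{C/C^τ} Y) = Y · τ • Y`.
[cite: CasselsFrohlichANT1967, Ch. VII §7.1] -/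
theorem ideleBaseChange_ideleRelNorm_eq_mul_smul [IsGalois (IntermediateField.fixedField (Subgroup.zpowers τ)) C]
    (hτ : τ * τ = 1) (hτ1 : τ ≠ 1) (Y : (AdeleRing (𝓞 C) C)ˣ) :
    AdeleRing.ideleBaseChange (↥(IntermediateField.fixedField (Subgroup.zpowers τ))) C
        (AdeleRing.ideleRelNorm (↥(IntermediateField.fixedField (Subgroup.zpowers τ))) C Y) = Y * τ • Y := by
  rw [AdeleRing.ideleBaseChange_ideleRelNorm, AdeleRing.ideleGalNorm_apply, prod_algEquiv_fixedField_eq τ hτ hτ1, one_smul,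
    subgroupEquivAlgEquiv_zpowers_smul_idele]

/-- **(E3) principal ideles descend to principal ideles**: for `a ∈ C`, `a ≠ 0`, `τ a = a`: `con((a)_{C^τ}) = (a)_C`.
[cite: CasselsFrohlichANT1967, Ch. VII §7.3 (a)] -/
theorem ideleBaseChange_principal_eq (a : C) (ha : τ a = a) (ha0 : a ≠ 0) :
    AdeleRing.ideleBaseChange (↥(IntermediateField.fixedField (Subgroup.zpowers τ))) C
        (IdeleHerbrand.principal (↥(IntermediateField.fixedField (Subgroup.zpowers τ)))
          (Units.mk0 ⟨a, mem_fixedField_of_apply_eq τ ha⟩ (fun h => ha0 (congrArg Subtype.val h)))) =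
      IdeleHerbrand.principal C (Units.mk0 a ha0) := by
  apply Units.ext
  rw [AdeleRing.coe_ideleBaseChange]
  change Literature.NumberTheory.Automorphic.AdeleRing.baseChange _ C
      (algebraMap _ _ ((⟨a, mem_fixedField_of_apply_eq τ ha⟩ :
        IntermediateField.fixedField (Subgroup.zpowers τ)) : ↥(IntermediateField.fixedField (Subgroup.zpowers τ)))) = _
  rw [Literature.NumberTheory.Automorphic.AdeleRing.baseChange_algebraMap]
  rfl

/-- `con((k)_{C^τ}) = (k)_C` for any unit `k` of the fixed field. [cite: CasselsFrohlichANT1967, Ch. VII §7.3 (a)] -/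
theorem coe_ideleBaseChange_principal (k : (↥(IntermediateField.fixedField (Subgroup.zpowers τ)))ˣ) :
    ((AdeleRing.ideleBaseChange (↥(IntermediateField.fixedField (Subgroup.zpowers τ))) C
        (IdeleHerbrand.principal (↥(IntermediateField.fixedField (Subgroup.zpowers τ))) k) : (AdeleRing (𝓞 C) C)ˣ) :
          AdeleRing (𝓞 C) C) =
      algebraMap C (AdeleRing (𝓞 C) C) ((k : ↥(IntermediateField.fixedField (Subgroup.zpowers τ))) : C) := by
  rw [AdeleRing.coe_ideleBaseChange]
  change Literature.NumberTheory.Automorphic.AdeleRing.baseChange _ C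
      (algebraMap _ _ (k : ↥(IntermediateField.fixedField (Subgroup.zpowers τ)))) = _
  rw [Literature.NumberTheory.Automorphic.AdeleRing.baseChange_algebraMap]
  rfl

/-- **(E5) the junction with the quadratic norm-residue indicator**: `con((k)_{C^τ} · N_{C/C^τ} Z) = (k)_C · (Z · τ • Z)` in `𝕀_C` — so
«`W = (k) · N(Z)`» (★ `quadraticArtinIndicator_eq_zero_iff_exists_ideleRelNorm`) for the descended idele `W` of `Y` ((E1)) says exactly
`Y = (k)_C · (Z · τ • Z)` with `k ∈ C^τ`, the hypothesis shape of ★ `exists_repr_of_adeleRingTensorAlgEquiv_map_eq` ((D4)).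
[cite: CasselsFrohlichANT1967, Ch. VII §7.3 (a)] [cite: Rogawski1990, §3.5 Prop. 3.5.2 (c)] -/
theorem coe_ideleBaseChange_principal_mul_ideleRelNorm [IsGalois (IntermediateField.fixedField (Subgroup.zpowers τ)) C]
    (hτ : τ * τ = 1) (hτ1 : τ ≠ 1) (k : (↥(IntermediateField.fixedField (Subgroup.zpowers τ)))ˣ) (Z : (AdeleRing (𝓞 C) C)ˣ) :
    ((AdeleRing.ideleBaseChange (↥(IntermediateField.fixedField (Subgroup.zpowers τ))) C
        (IdeleHerbrand.principal (↥(IntermediateField.fixedField (Subgroup.zpowers τ))) k *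
          AdeleRing.ideleRelNorm (↥(IntermediateField.fixedField (Subgroup.zpowers τ))) C Z) : (AdeleRing (𝓞 C) C)ˣ) :
            AdeleRing (𝓞 C) C) =
      algebraMap C (AdeleRing (𝓞 C) C) ((k : ↥(IntermediateField.fixedField (Subgroup.zpowers τ))) : C) *
        ((Z : AdeleRing (𝓞 C) C) * τ • (Z : AdeleRing (𝓞 C) C)) := by
  rw [map_mul, Units.val_mul, coe_ideleBaseChange_principal, ideleBaseChange_ideleRelNorm_eq_mul_smul τ hτ hτ1, Units.val_mul,
    AdeleRing.coe_smul_units]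

end Descent

/-! ## §2 (E4) The composite at a `τ_B`-stable factor `π : B → C`: the descended idele of a `τ_B`-fixed adelic unit -/

section Composite

open scoped NumberField.AdeleRing
open Literature.NumberTheory.AdelicBaseChange Literature.NumberTheory.Automorphic

variable {F B C : Type} [Field F] [NumberField F] [CommRing B] [Algebra F B] [Field C] [NumberField C] [Algebra F C]
  (τB : B ≃ₐ[F] B) (π : B →ₐ[F] C) (τ : C ≃ₐ[F] C) (hτπ : ∀ b, π (τB b) = τ (π b))
include hτπ

/-- **The idele `Z_π(X) ∈ 𝕀_C` of an adelic unit `X ∈ (𝔸_F ⊗_F B)ˣ` at the factor `π`** (`e_C ∘ (1 ⊗ π)` on units) is `τ`-FIXED when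
`X` is `τ_B`-fixed ((D1) ★ `smul_adeleRingTensorAlgEquiv_map_eq_self`). [cite: CasselsFrohlichANT1967, Ch. VII §7.1] -/
theorem smul_unitsMap_eq_self {X : (AdeleRing (𝓞 F) F ⊗[F] B)ˣ}
    (hX : Algebra.TensorProduct.map (AlgHom.id (AdeleRing (𝓞 F) F) (AdeleRing (𝓞 F) F)) (τB : B →ₐ[F] B) X = X) :
    τ • Units.map ((adeleRingTensorAlgEquiv F C).toAlgHom.comp
        (Algebra.TensorProduct.map (AlgHom.id (AdeleRing (𝓞 F) F) (AdeleRing (𝓞 F) F)) π)).toRingHom.toMonoidHom X =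
      Units.map ((adeleRingTensorAlgEquiv F C).toAlgHom.comp
        (Algebra.TensorProduct.map (AlgHom.id (AdeleRing (𝓞 F) F) (AdeleRing (𝓞 F) F)) π)).toRingHom.toMonoidHom X := by
  apply Units.ext
  rw [AdeleRing.coe_smul_units]
  exact smul_adeleRingTensorAlgEquiv_map_eq_self τB π τ hτπ hX

/-- **(E4) the descended idele of `X = (1 ⊗ b) · t · (1 ⊗ τ_B)t` is `(π b)_{C^τ} · N_{C/C^τ}(Z_π(t))`** (read after base change to `𝕀_C`,
where the base change is injective): principal times idelic norm — so every quadratic norm-residue indicator of `C ∕ C^τ` vanishes on it.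
[cite: Rogawski1990, §3.5 Prop. 3.5.2 (c)] [cite: CasselsFrohlichANT1967, Ch. VII §7.3 (a)] -/
theorem ideleBaseChange_principal_mul_ideleRelNorm_eq [IsGalois (IntermediateField.fixedField (Subgroup.zpowers τ)) C]
    (hτ : τ * τ = 1) (hτ1 : τ ≠ 1) (b : B) (hπb : τ (π b) = π b) (hπb0 : π b ≠ 0) (X t : (AdeleRing (𝓞 F) F ⊗[F] B)ˣ)
    (hXt : (X : AdeleRing (𝓞 F) F ⊗[F] B) = (1 : AdeleRing (𝓞 F) F) ⊗ₜ b * (t : AdeleRing (𝓞 F) F ⊗[F] B) *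
      Algebra.TensorProduct.map (AlgHom.id (AdeleRing (𝓞 F) F) (AdeleRing (𝓞 F) F)) (τB : B →ₐ[F] B) (t : AdeleRing (𝓞 F) F ⊗[F] B)) :
    AdeleRing.ideleBaseChange (↥(IntermediateField.fixedField (Subgroup.zpowers τ))) C
        (IdeleHerbrand.principal (↥(IntermediateField.fixedField (Subgroup.zpowers τ)))
            (Units.mk0 ⟨π b, mem_fixedField_of_apply_eq τ hπb⟩ (fun h => hπb0 (congrArg Subtype.val h))) *
          AdeleRing.ideleRelNorm (↥(IntermediateField.fixedField (Subgroup.zpowers τ))) C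
            (Units.map ((adeleRingTensorAlgEquiv F C).toAlgHom.comp
              (Algebra.TensorProduct.map (AlgHom.id (AdeleRing (𝓞 F) F) (AdeleRing (𝓞 F) F)) π)).toRingHom.toMonoidHom t)) =
      Units.map ((adeleRingTensorAlgEquiv F C).toAlgHom.comp
        (Algebra.TensorProduct.map (AlgHom.id (AdeleRing (𝓞 F) F) (AdeleRing (𝓞 F) F)) π)).toRingHom.toMonoidHom X := by
  rw [map_mul, ideleBaseChange_ideleRelNorm_eq_mul_smul τ hτ hτ1, ideleBaseChange_principal_eq τ (π b) hπb hπb0]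
  apply Units.ext
  rw [Units.val_mul, Units.val_mul, AdeleRing.coe_smul_units]
  change algebraMap C (AdeleRing (𝓞 C) C) (π b) *
      (adeleRingTensorAlgEquiv F C (Algebra.TensorProduct.map (AlgHom.id (AdeleRing (𝓞 F) F) (AdeleRing (𝓞 F) F)) π t) *
        τ • adeleRingTensorAlgEquiv F C (Algebra.TensorProduct.map (AlgHom.id (AdeleRing (𝓞 F) F) (AdeleRing (𝓞 F) F)) π t)) =
    adeleRingTensorAlgEquiv F C (Algebra.TensorProduct.map (AlgHom.id (AdeleRing (𝓞 F) F) (AdeleRing (𝓞 F) F)) π X)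
  rw [hXt, adeleRingTensorAlgEquiv_map_tmul_mul_mul_map τB π τ hτπ]

end Composite

/-! ## §3 (P4 at a factor) The quadratic norm-residue indicator of the descended idele vanishes iff the representative data exist -/

section Indicator

open scoped NumberField.AdeleRing
open Literature.NumberTheory.AdelicBaseChange Literature.NumberTheory.Automorphic

variable {F C : Type} [Field F] [NumberField F] [Field C] [NumberField C] [Algebra F C] (τ : C ≃ₐ[F] C)

variable {B : Type} [CommRing B] [Algebra F B] (τB : B ≃ₐ[F] B) (π : B →ₐ[F] C) (hτπ : ∀ b, π (τB b) = τ (π b))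
include hτπ

/-- **(P4 at a factor) the quadratic norm-residue indicator of the DESCENDED idele `W` (`con W = Z_π(X)`) of an adelic unit `X` at the
factor `π : B → C` VANISHES iff `X` has the representative data «principal `τ`-fixed × norm modulo `ker π`»** — the two halves of
`cartanObs_𝔪 = 0 ⟺ local-global class` at one `τ`-stable factor: (→) ★ (J4) `quadraticArtinIndicator_fixedField_eq_zero_iff` ⇒ (E5) ⇒
★ (D4) `exists_repr_of_adeleRingTensorAlgEquiv_map_eq`; (←) the norm reading ★ (D1) + (E5) + injectivity of the base change.  Here `δ ∈ C`
with `τ δ = −δ ≠ 0`, `δ² = d ∈ C^τ` presents `C = C^τ(√d)` (for the Cartan factors: `δ = π(ε · 1)`, `d = ε² ∈ F`).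
[cite: Rogawski1990, §3.5 Prop. 3.5.2 (c)] [cite: CasselsFrohlichANT1967, Ch. VII §7.3 (a)] -/
theorem quadraticArtinIndicator_eq_zero_iff_exists_repr [IsGalois (IntermediateField.fixedField (Subgroup.zpowers τ)) C]
    (hτ : τ * τ = 1) (hτ1 : τ ≠ 1) (hπ : Function.Surjective π) {δ : C} (hδ : τ δ = -δ) (hδ0 : δ ≠ 0)
    {d : ↥(IntermediateField.fixedField (Subgroup.zpowers τ))}
    (hd : δ * δ = algebraMap (↥(IntermediateField.fixedField (Subgroup.zpowers τ))) C d)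
    (X : (AdeleRing (𝓞 F) F ⊗[F] B)ˣ)
    (W : (AdeleRing (𝓞 ↥(IntermediateField.fixedField (Subgroup.zpowers τ))) ↥(IntermediateField.fixedField (Subgroup.zpowers τ)))ˣ)
    (hW : AdeleRing.ideleBaseChange (↥(IntermediateField.fixedField (Subgroup.zpowers τ))) C W =
      Units.map ((adeleRingTensorAlgEquiv F C).toAlgHom.comp
        (Algebra.TensorProduct.map (AlgHom.id (AdeleRing (𝓞 F) F) (AdeleRing (𝓞 F) F)) π)).toRingHom.toMonoidHom X) :
    quadraticArtinIndicator (↥(IntermediateField.fixedField (Subgroup.zpowers τ))) d W = 0 ↔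
      ∃ (k : B) (u u' : AdeleRing (𝓞 F) F ⊗[F] B), π k ≠ 0 ∧ π (τB k) = π k ∧
        Algebra.TensorProduct.map (AlgHom.id (AdeleRing (𝓞 F) F) (AdeleRing (𝓞 F) F)) π (u * u') = 1 ∧
        Algebra.TensorProduct.map (AlgHom.id (AdeleRing (𝓞 F) F) (AdeleRing (𝓞 F) F)) π X =
          Algebra.TensorProduct.map (AlgHom.id (AdeleRing (𝓞 F) F) (AdeleRing (𝓞 F) F)) π
            ((1 : AdeleRing (𝓞 F) F) ⊗ₜ k * u *
              Algebra.TensorProduct.map (AlgHom.id (AdeleRing (𝓞 F) F) (AdeleRing (𝓞 F) F)) (τB : B →ₐ[F] B) u) := by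
  have hZX : ((Units.map ((adeleRingTensorAlgEquiv F C).toAlgHom.comp
        (Algebra.TensorProduct.map (AlgHom.id (AdeleRing (𝓞 F) F) (AdeleRing (𝓞 F) F)) π)).toRingHom.toMonoidHom X :
          (AdeleRing (𝓞 C) C)ˣ) : AdeleRing (𝓞 C) C) =
      adeleRingTensorAlgEquiv F C (Algebra.TensorProduct.map (AlgHom.id (AdeleRing (𝓞 F) F) (AdeleRing (𝓞 F) F)) π X) := rfl
  rw [quadraticArtinIndicator_fixedField_eq_zero_iff τ hτ hτ1 hδ hδ0 hd]
  constructor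
  · rintro ⟨k, Z, hk⟩
    have h := congrArg (fun V : (AdeleRing (𝓞 ↥(IntermediateField.fixedField (Subgroup.zpowers τ)))
        ↥(IntermediateField.fixedField (Subgroup.zpowers τ)))ˣ =>
      ((AdeleRing.ideleBaseChange (↥(IntermediateField.fixedField (Subgroup.zpowers τ))) C V : (AdeleRing (𝓞 C) C)ˣ) :
        AdeleRing (𝓞 C) C)) hk
    rw [hW, hZX] at h
    change _ = ((AdeleRing.ideleBaseChange _ C (IdeleHerbrand.principal _ k * AdeleRing.ideleRelNorm _ C Z) : (AdeleRing (𝓞 C) C)ˣ) :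
      AdeleRing (𝓞 C) C) at h
    rw [coe_ideleBaseChange_principal_mul_ideleRelNorm τ hτ hτ1] at h
    exact exists_repr_of_adeleRingTensorAlgEquiv_map_eq τB π τ hτπ hπ
      (fun h0 => k.ne_zero (Subtype.ext h0)) (apply_fixedField τ (k : ↥(IntermediateField.fixedField (Subgroup.zpowers τ)))) Z h
  · rintro ⟨k, u, u', hk0, hkτ, huu', hX⟩
    -- the idele `Z = e_C((1 ⊗ π) u)` (a unit: `(1 ⊗ π)(u u′) = 1`)
    have hZZ' : adeleRingTensorAlgEquiv F C (Algebra.TensorProduct.map (AlgHom.id (AdeleRing (𝓞 F) F) (AdeleRing (𝓞 F) F)) π u) *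
        adeleRingTensorAlgEquiv F C (Algebra.TensorProduct.map (AlgHom.id (AdeleRing (𝓞 F) F) (AdeleRing (𝓞 F) F)) π u') = 1 := by
      rw [← map_mul, ← map_mul, huu', map_one]
    let Z : (AdeleRing (𝓞 C) C)ˣ := ⟨_, _, hZZ', (mul_comm _ _).trans hZZ'⟩
    have hkτ' : τ (π k) = π k := by rw [← hτπ, hkτ]
    refine ⟨Units.mk0 ⟨π k, mem_fixedField_of_apply_eq τ hkτ'⟩ (fun h => hk0 (congrArg Subtype.val h)), Z, ?_⟩
    apply AdeleRing.ideleBaseChange_injective _ C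
    apply Units.ext
    rw [hW, hZX, hX, adeleRingTensorAlgEquiv_map_tmul_mul_mul_map τB π τ hτπ]
    change _ = ((AdeleRing.ideleBaseChange _ C (IdeleHerbrand.principal _ _ * AdeleRing.ideleRelNorm _ C Z) : (AdeleRing (𝓞 C) C)ˣ) :
      AdeleRing (𝓞 C) C)
    rw [coe_ideleBaseChange_principal_mul_ideleRelNorm τ hτ hτ1]
    rfl

end Indicator

end Literature.NumberTheory.GaloisRepresentations
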